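/-
Copyright (c) 2026 the pub-hodgecm-mathlib formalisation cell (harness21).  Prover seat hodgecm-mathlib-K2E4-p23 (g2), Track B ∕ K2-LIT, h413 =
`stmt-HodgeConjecture-24833`, ENGINE E1, 5Res campaign, deal (113) of the dealer K2E1-plan (g6), part (iii) (R34 own-block continuation): the circle average PUSHED
THROUGH THE BOREL EISENSTEIN SERIES.
-/
import Summits.HodgeConjecture.HodgeConjecture.Theorems.K2E1ArchTorusActionFlatSectionU11   -- ★ p859704 (this seat) (113)(ii-b): `circleAverage_torusAt_eq`, `localBorel_entries`, `bracket_eq`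
import Summits.HodgeConjecture.HodgeConjecture.Theorems.K2E1BorelEisensteinGodementU           -- ★ `countable_unitaryGroupOfForm` (index of `eisensteinSeriesU` countable); brings `eisensteinSeriesU`
import Mathlib.MeasureTheory.Integral.DominatedConvergence
import Mathlib.Analysis.SpecialFunctions.Pow.Continuity
import HarnessLib

/-!
# K2·E1 — `K2E1ArchTorusActionEisensteinU11`: THE CIRCLE AVERAGE ALONG THE SINGLE-PLACE TORUS COMMUTES WITH THE BOREL EISENSTEIN SERIES
# (deal (113)(iii): `∫₀^{2π} e^{−iqθ} E(f)(g·k_w(θ)·t_w(a)) dθ = (∫₀^{2π} archTorusIntegrand s (p − q) a θ dθ) · E(f)(g)` on the domain of absolute convergence)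

Track B ∕ K2-LIT, crux h413 = `stmt-HodgeConjecture-24833`, route of record `HCCMUnconditional`; cell `hodgecm-mathlib`, squad K2, ENGINE E1 (5Res campaign, ARCH-UNITARITY leg).
Prover seat `hodgecm-mathlib-K2E4-p23` (g2); deal (113) of K2E1-plan (g6), continued under R34 (K2-lead (g1), 2026-09-04T11:21:18Z).  THEOREMS ONLY (no `def`, no `instance`, no
notation, no named-fact hypothesis, no `sorry`); lane `--supports stmt-HodgeConjecture-24833 --as helper` (count-neutral).  CLOSES NO SOCKET.

WHAT.  Letters (G) (K) (B) on an arbitrary `f : U(J₂)(𝔸_{L⁺}) → ℂ` exactly as in ★ (ii-b) `K2E1ArchTorusActionFlatSectionU11` (for `f = flatSectionU φ z`, `s = z + it_w`).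
* §1 `exists_phase_eq` — the POINTWISE edition of ★ (ii-b): `∃ θ₁, ∀ θ, e^{−iqθ} f(g·circleAt 1 (e^{iθ})·torusAt a) = archTorusIntegrand s (p−q) a (θ+θ₁) · f(g)`.
* §2 `continuous_archTorusIntegrand`, `exists_forall_norm_archTorusIntegrand_le` — the integrand is continuous and (being `2π`-periodic) uniformly bounded in `θ`.
* §3 **`circleAverage_torusAt_eisensteinSeriesU_eq`**: if `Σ_q ‖f(γ̃_q g)‖ < ∞` at the ONE point `g` (★ Godement currency `summable_eisensteinSeriesU_flatSectionU_cm_two` on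
  `1 < Re z`), then `∫₀^{2π} e^{−iqθ} E(f)(g·circleAt 1 (e^{iθ})·torusAt a) dθ = (∫₀^{2π} archTorusIntegrand s (p − q) a θ dθ)·E(f)(g)`, and the normalised form with ★ `archTorusCoeff`
  (`…_eq_archTorusCoeff_mul`): domination `‖term_q(θ)‖ ≤ M·‖f(γ̃_q g)‖` by §1 + §2, interchange by Mathlib's `intervalIntegral.hasSum_integral_of_dominated_convergence`,
  termwise by ★ (ii-b) at the points `γ̃_q g`.
With ★ F2b∕F3 (`arch_unitarity_of_rightRegular_matrixCoeff`) this is the Eisenstein-series half of the letter `hmc` on the Godement domain; the residue half (continuation to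
`Re z ≤ 1` and the residual form) waits for the (χ,τ)-continuation (TABLE row 13).
HONEST LABEL: HC_CM is proved only modulo the 7 printed citations (2 remaining named inputs: hLiu418 = `stmt-HodgeConjecture-24832`, h413 = `stmt-HodgeConjecture-24833`) until rung 0
closes; this file asserts no named fact and closes no socket; count-neutral.

## References
* [Knapp1986] A. W. Knapp, *Representation Theory of Semisimple Groups* (1986), VII §1.
* [MoeglinWaldspurger1995] C. Mœglin, J.-L. Waldspurger (1995), II.1.5, IV.3.
* [Garrett2018] P. Garrett, *Modern Analysis of Automorphic Forms by Example* (2018), §3.10.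
-/

set_option autoImplicit false
-- the mandated namespace repeats the single-problem summit's segment (`HodgeConjecture.HodgeConjecture`)
set_option linter.dupNamespace false

noncomputable section

open NumberField NumberField.InfinitePlace Matrix MeasureTheory intervalIntegral
open scoped MatrixGroups ComplexConjugate Real
open Literature.NumberTheory.Automorphic Literature.NumberTheory.Automorphic.UnitaryGroup AdelicGroupData
open Summit.HodgeConjecture.HodgeConjecture.Cruxes.H413.K2E1ArchTorusFamilyU11Defs
open Summit.HodgeConjecture.HodgeConjecture.Cruxes.H413.K2E1ArchTorusCoefficientU11Defs
open Summit.HodgeConjecture.HodgeConjecture.Cruxes.H413.K2E1ArchLocalIwasawaU11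
open Summit.HodgeConjecture.HodgeConjecture.Cruxes.H413.K2E1ArchTorusActionFlatSectionU11
open Summit.HodgeConjecture.HodgeConjecture.Cruxes.H413.K2E1BorelEisensteinU

namespace Summit.HodgeConjecture.HodgeConjecture.Cruxes.H413.K2E1ArchTorusActionEisensteinU11

variable (L : Type) [Field L] [NumberField L] [IsCMField L] (w : {w : InfinitePlace L // IsComplex w})

/-! ## §1 The pointwise edition of ★ (ii-b) -/

/-- **POINTWISE PHASE FORM.**  Under the letters (G) (K) (B): for `a > 0` and every `g` there is a phase `θ₁` (from the Iwasawa data of `g`: `e^{iθ₁} = v₀∕u₀`) with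
`e^{−iqθ}·f(g · circleAt 1 (e^{iθ}) · torusAt a) = archTorusIntegrand s (p − q) a (θ + θ₁) · f(g)` for ALL `θ` (same bookkeeping as ★ `circleAverage_torusAt_eq`). [cite: Knapp1986, VII §1] -/
theorem exists_phase_eq (f : (quasiSplit (↥(maximalRealSubfield L)) L (IsCMField.complexConj L) 2).Adelic → ℂ) (s : ℂ) (p q : ℤ)
    (hBglob : ∀ b ∈ borelAdelic (↥(maximalRealSubfield L)) L (IsCMField.complexConj L) 2, ∃ c : ℂ, ∀ x, f (b * x) = c * f x)
    (hK : ∀ x (u v : Circle), f (x * circleAt L w u v) = (u : ℂ) ^ p * (v : ℂ) ^ q * f x)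
    (hB : ∀ (b : archLocal L 2 ((StdForm.antidiagonal 2).over L) w) (r : ℝ), 0 < r →
      (((b : GL (Fin 2) ℂ) : Matrix (Fin 2) (Fin 2) ℂ) 1 0 = 0) → (((b : GL (Fin 2) ℂ) : Matrix (Fin 2) (Fin 2) ℂ) 0 0 = (r : ℂ)) →
      ∀ x, f (adelicSingle (↥(maximalRealSubfield L)) L (IsCMField.complexConj L) 2 ((StdForm.antidiagonal 2).over L) (IsCMField.complexConj_ne_one L)
        (complexConj_smul_infinitePlace L) w b * x) = ((r ^ 2 : ℝ) : ℂ) ^ s * f x)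
    {a : ℝ} (ha : 0 < a)
    (g : (quasiSplit (↥(maximalRealSubfield L)) L (IsCMField.complexConj L) 2).Adelic) :
    ∃ θ₁ : ℝ, ∀ θ : ℝ, Complex.exp (-((q : ℂ) * θ * Complex.I)) * f (g * circleAt L w 1 (Circle.exp θ) * torusAt L w a) =
      archTorusIntegrand s (p - q) a (θ + θ₁) * f g := by
  -- global Iwasawa and the splitting of the compact factor at `w`
  obtain ⟨b₀, hb₀, k₀, hk₀, rfl⟩ := exists_mem_borelAdelic_mul_mem_standardMaximalCompactGL_cm L (N := 2) g
  obtain ⟨c₀, hc₀⟩ := hBglob b₀ hb₀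
  obtain ⟨k', hk', hk₀eq⟩ := exists_eq_adelicSingle_mul (↥(maximalRealSubfield L)) L (IsCMField.complexConj L) 2 ((StdForm.antidiagonal 2).over L)
    (IsCMField.complexConj_ne_one L) (complexConj_smul_infinitePlace L) w k₀
  have hk₀K : k₀ ∈ ((standardMaximalCompactGL 2 L).comap (adelicVal ↥(maximalRealSubfield L) L (IsCMField.complexConj L) 2 ((StdForm.antidiagonal 2).over L)) :
      Subgroup (quasiSplit (↥(maximalRealSubfield L)) L (IsCMField.complexConj L) 2).Adelic) := hk₀
  obtain ⟨u₀, v₀, hκ⟩ := exists_archAt_archPart_eq_circleLoc L w hk₀K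
  rw [hκ] at hk₀eq
  -- notation: `ι = adelicSingle w`, the commuting element `k′`
  have hcomm : ∀ u : archLocal L 2 ((StdForm.antidiagonal 2).over L) w,
      k' * adelicSingle (↥(maximalRealSubfield L)) L (IsCMField.complexConj L) 2 ((StdForm.antidiagonal 2).over L) (IsCMField.complexConj_ne_one L)
        (complexConj_smul_infinitePlace L) w u =
      adelicSingle (↥(maximalRealSubfield L)) L (IsCMField.complexConj L) 2 ((StdForm.antidiagonal 2).over L) (IsCMField.complexConj_ne_one L)
        (complexConj_smul_infinitePlace L) w u * k' := fun u =>
    (commute_adelicSingle_of_mem_awayFrom (↥(maximalRealSubfield L)) L (IsCMField.complexConj L) 2 ((StdForm.antidiagonal 2).over L)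
      (IsCMField.complexConj_ne_one L) (complexConj_smul_infinitePlace L) w u hk').eq
  -- the phase `θ₁` with `e^{iθ₁} = v₀∕u₀`
  set θ₁ : ℝ := Complex.arg (((u₀⁻¹ * v₀ : Circle)) : ℂ) with hθ₁def
  have hθ₁C : Circle.exp θ₁ = u₀⁻¹ * v₀ := Circle.exp_arg _
  have hθ₁ : Complex.exp ((θ₁ : ℂ) * Complex.I) = (v₀ : ℂ) / (u₀ : ℂ) := by
    rw [← Circle.coe_exp, hθ₁C, Circle.coe_mul, Circle.coe_inv, div_eq_inv_mul]
  have hu₀ : ((u₀ : Circle) : ℂ) ≠ 0 := Circle.coe_ne_zero u₀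
  have hcommC : ∀ u v : Circle, circleAt L w u v * k' = k' * circleAt L w u v := fun u v => by
    rw [circleAt_def]; exact (hcomm _).symm
  -- `f(g)`
  have hfg : f (b₀ * k₀) = c₀ * ((u₀ : ℂ) ^ p * (v₀ : ℂ) ^ q * f k') := by
    rw [hc₀, hk₀eq, ← circleAt_def, hcommC, hK]
  -- the pointwise identity
  have hpt : ∀ θ : ℝ, Complex.exp (-((q : ℂ) * θ * Complex.I)) * f (b₀ * k₀ * circleAt L w 1 (Circle.exp θ) * torusAt L w a) =
      (c₀ * ((u₀ : ℂ) ^ p * (v₀ : ℂ) ^ q * f k')) * archTorusIntegrand s (p - q) a (θ + θ₁) := by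
    intro θ
    set W : ℂ := torusW a (θ + θ₁) with hWdef
    have hW : W ≠ 0 := torusW_ne_zero ha _
    -- the local Borel element and the rotated circle element
    set uu : Circle := Circle.exp (Complex.arg W) with huu
    set bL : archLocal L 2 ((StdForm.antidiagonal 2).over L) w :=
      circleLoc L w 1 (Circle.exp (θ + θ₁)) * torusLoc L w (Real.log a) * (circleLoc L w uu (Circle.exp (θ + θ₁) * uu⁻¹))⁻¹ with hbL
    obtain ⟨h10, h00⟩ := localBorel_entries L w ha (θ + θ₁)
    -- group-level rearrangement: `k₀ · circleAt 1 ζ · torusAt a = ι(bL) · circleAt (uu·u₀) (ζ′uu⁻¹·u₀) · k′`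
    have hgrp : k₀ * (circleAt L w 1 (Circle.exp θ) * torusAt L w a) =
        adelicSingle (↥(maximalRealSubfield L)) L (IsCMField.complexConj L) 2 ((StdForm.antidiagonal 2).over L) (IsCMField.complexConj_ne_one L)
          (complexConj_smul_infinitePlace L) w bL * (circleAt L w (uu * u₀) (Circle.exp (θ + θ₁) * uu⁻¹ * u₀) * k') := by
      have hloc : circleLoc L w u₀ v₀ * circleLoc L w 1 (Circle.exp θ) * torusLoc L w (Real.log a) =
          bL * circleLoc L w (uu * u₀) (Circle.exp (θ + θ₁) * uu⁻¹ * u₀) := by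
        rw [circleLoc_mul_circleLoc_one, show u₀⁻¹ * v₀ * Circle.exp θ = Circle.exp (θ + θ₁) by rw [Circle.exp_add, hθ₁C]; exact mul_comm _ _,
          mul_assoc, circleLoc_self_mul_comm, ← mul_assoc, hbL, circleLoc_mul L w uu u₀ (Circle.exp (θ + θ₁) * uu⁻¹) u₀, ← mul_assoc,
          inv_mul_cancel_right]
      rw [hk₀eq, circleAt_def, torusAt_def, mul_assoc, ← map_mul, hcomm, ← mul_assoc, ← map_mul, ← mul_assoc (circleLoc L w u₀ v₀), hloc,
        map_mul, ← circleAt_def, mul_assoc]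
    rw [mul_assoc (b₀ * k₀), mul_assoc b₀, hgrp, hc₀, hB bL (2 / ‖W‖) (by positivity) h10 h00, hcommC, hK]
    -- the scalars
    have hbr := bracket_eq s p q ha θ θ₁ hu₀ hθ₁
    have huuC : ((uu : Circle) : ℂ) = W / (‖W‖ : ℂ) := by
      have hn : (‖W‖ : ℂ) ≠ 0 := Complex.ofReal_ne_zero.2 (norm_ne_zero_iff.2 hW)
      rw [huu, Circle.coe_exp, eq_div_iff hn, mul_comm]
      exact_mod_cast Complex.norm_mul_exp_arg_mul_I W
    rw [Circle.coe_mul, Circle.coe_mul, Circle.coe_mul, Circle.coe_inv, huuC, Circle.coe_exp, mul_zpow, mul_zpow]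
    rw [← hWdef] at hbr
    push_cast at hbr ⊢
    linear_combination (c₀ * (u₀ : ℂ) ^ p * f k') * hbr
  exact ⟨θ₁, fun θ => by rw [hpt θ, hfg]; ring⟩

/-! ## §2 The integrand is continuous and uniformly bounded -/

omit [NumberField L] [IsCMField L] in
/-- `θ ↦ archTorusIntegrand s m a θ` is continuous (`a > 0`: the base `|W|²∕4 > 0` stays in the slit plane, `W ≠ 0`). [folklore] -/
theorem continuous_archTorusIntegrand (s : ℂ) (m : ℤ) {a : ℝ} (ha : 0 < a) : Continuous (archTorusIntegrand s m a) := by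
  have hW := continuous_torusW a
  unfold archTorusIntegrand
  refine Continuous.mul ?_ ?_
  · refine Continuous.cpow ?_ continuous_const fun θ => ?_
    · exact Complex.continuous_ofReal.comp ((Complex.continuous_normSq.comp hW).div_const _)
    · exact Complex.ofReal_mem_slitPlane.2 (by have := Complex.normSq_pos.2 (torusW_ne_zero ha θ); positivity)
  · refine Continuous.zpow₀ (hW.div (Complex.continuous_ofReal.comp hW.norm) fun θ => ?_) m fun θ => Or.inl ?_
    · exact Complex.ofReal_ne_zero.2 (norm_ne_zero_iff.2 (torusW_ne_zero ha θ))
    · exact div_ne_zero (torusW_ne_zero ha θ) (Complex.ofReal_ne_zero.2 (norm_ne_zero_iff.2 (torusW_ne_zero ha θ)))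

omit [NumberField L] [IsCMField L] in
/-- A uniform bound: `∃ M, ∀ θ, ‖archTorusIntegrand s m a θ‖ ≤ M` (continuous and `2π`-periodic). [folklore] -/
theorem exists_forall_norm_archTorusIntegrand_le (s : ℂ) (m : ℤ) {a : ℝ} (ha : 0 < a) : ∃ M : ℝ, ∀ θ : ℝ, ‖archTorusIntegrand s m a θ‖ ≤ M := by
  obtain ⟨M, hM⟩ := ((periodic_archTorusIntegrand s m a).isBounded_of_continuous (by positivity) (continuous_archTorusIntegrand s m ha)).exists_norm_le
  exact ⟨M, fun θ => hM _ (Set.mem_range_self θ)⟩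

/-! ## §3 Through the Eisenstein series -/

/-- **THE CIRCLE AVERAGE COMMUTES WITH `E(f)`.**  Letters (G) (K) (B) on `f`, `a > 0`, and absolute convergence of the Eisenstein series at the ONE point `g`
(`hsum`, ★ Godement currency): `∫₀^{2π} e^{−iqθ}·E(f)(g · circleAt 1 (e^{iθ}) · torusAt a) dθ = (∫₀^{2π} archTorusIntegrand s (p − q) a θ dθ) · E(f)(g)`.
Domination `‖e^{−iqθ} f(γ̃_q g k_θ t_a)‖ ≤ M‖f(γ̃_q g)‖` (§1, §2); DCT for series (Mathlib); termwise ★ (ii-b). [cite: MoeglinWaldspurger1995, II.1.5] [cite: Knapp1986, VII §1] -/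
theorem circleAverage_torusAt_eisensteinSeriesU_eq (f : (quasiSplit (↥(maximalRealSubfield L)) L (IsCMField.complexConj L) 2).Adelic → ℂ) (s : ℂ) (p q : ℤ)
    (hBglob : ∀ b ∈ borelAdelic (↥(maximalRealSubfield L)) L (IsCMField.complexConj L) 2, ∃ c : ℂ, ∀ x, f (b * x) = c * f x)
    (hK : ∀ x (u v : Circle), f (x * circleAt L w u v) = (u : ℂ) ^ p * (v : ℂ) ^ q * f x)
    (hB : ∀ (b : archLocal L 2 ((StdForm.antidiagonal 2).over L) w) (r : ℝ), 0 < r →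
      (((b : GL (Fin 2) ℂ) : Matrix (Fin 2) (Fin 2) ℂ) 1 0 = 0) → (((b : GL (Fin 2) ℂ) : Matrix (Fin 2) (Fin 2) ℂ) 0 0 = (r : ℂ)) →
      ∀ x, f (adelicSingle (↥(maximalRealSubfield L)) L (IsCMField.complexConj L) 2 ((StdForm.antidiagonal 2).over L) (IsCMField.complexConj_ne_one L)
        (complexConj_smul_infinitePlace L) w b * x) = ((r ^ 2 : ℝ) : ℂ) ^ s * f x)
    {a : ℝ} (ha : 0 < a)
    (g : (quasiSplit (↥(maximalRealSubfield L)) L (IsCMField.complexConj L) 2).Adelic)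
    (hsum : Summable fun qq : Quotient (MulAction.orbitRel ↥(borelU ((IsCMField.complexConj L : L ≃ₐ[↥(maximalRealSubfield L)] L) : L →+* L) ((StdForm.antidiagonal 2).over L))
        ↥(unitaryGroupOfForm ((IsCMField.complexConj L : L ≃ₐ[↥(maximalRealSubfield L)] L) : L →+* L) ((StdForm.antidiagonal 2).over L))) =>
      ‖f (((quasiSplit (↥(maximalRealSubfield L)) L (IsCMField.complexConj L) 2).toAdelic
          (Quotient.out qq : ↥(unitaryGroupOfForm ((IsCMField.complexConj L : L ≃ₐ[↥(maximalRealSubfield L)] L) : L →+* L) ((StdForm.antidiagonal 2).over L)))) * g)‖) :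
    ∫ θ in (0 : ℝ)..2 * π, Complex.exp (-((q : ℂ) * θ * Complex.I)) *
        eisensteinSeriesU f (g * circleAt L w 1 (Circle.exp θ) * torusAt L w a) =
      (∫ θ in (0 : ℝ)..2 * π, archTorusIntegrand s (p - q) a θ) * eisensteinSeriesU f g := by
  haveI : Countable ↥(unitaryGroupOfForm ((IsCMField.complexConj L : L ≃ₐ[↥(maximalRealSubfield L)] L) : L →+* L) ((StdForm.antidiagonal 2).over L)) :=
    K2E1BorelEisensteinGodementU.countable_unitaryGroupOfForm (c := IsCMField.complexConj L) _
  obtain ⟨M, hM⟩ := exists_forall_norm_archTorusIntegrand_le s (p - q) ha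
  -- the phases of the points `γ̃_q g`
  choose θ₁ hθ₁ using fun qq : Quotient (MulAction.orbitRel ↥(borelU ((IsCMField.complexConj L : L ≃ₐ[↥(maximalRealSubfield L)] L) : L →+* L) ((StdForm.antidiagonal 2).over L))
        ↥(unitaryGroupOfForm ((IsCMField.complexConj L : L ≃ₐ[↥(maximalRealSubfield L)] L) : L →+* L) ((StdForm.antidiagonal 2).over L))) =>
    exists_phase_eq L w f s p q hBglob hK hB ha (((quasiSplit (↥(maximalRealSubfield L)) L (IsCMField.complexConj L) 2).toAdelic
          (Quotient.out qq : ↥(unitaryGroupOfForm ((IsCMField.complexConj L : L ≃ₐ[↥(maximalRealSubfield L)] L) : L →+* L) ((StdForm.antidiagonal 2).over L)))) * g)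
  -- the terms, rewritten pointwise
  have hterm : ∀ (qq : Quotient (MulAction.orbitRel ↥(borelU ((IsCMField.complexConj L : L ≃ₐ[↥(maximalRealSubfield L)] L) : L →+* L) ((StdForm.antidiagonal 2).over L))
        ↥(unitaryGroupOfForm ((IsCMField.complexConj L : L ≃ₐ[↥(maximalRealSubfield L)] L) : L →+* L) ((StdForm.antidiagonal 2).over L)))) (θ : ℝ),
      Complex.exp (-((q : ℂ) * θ * Complex.I)) * f (((quasiSplit (↥(maximalRealSubfield L)) L (IsCMField.complexConj L) 2).toAdelic
          (Quotient.out qq : ↥(unitaryGroupOfForm ((IsCMField.complexConj L : L ≃ₐ[↥(maximalRealSubfield L)] L) : L →+* L) ((StdForm.antidiagonal 2).over L)))) * (g * circleAt L w 1 (Circle.exp θ) * torusAt L w a)) =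
        archTorusIntegrand s (p - q) a (θ + θ₁ qq) * f (((quasiSplit (↥(maximalRealSubfield L)) L (IsCMField.complexConj L) 2).toAdelic
          (Quotient.out qq : ↥(unitaryGroupOfForm ((IsCMField.complexConj L : L ≃ₐ[↥(maximalRealSubfield L)] L) : L →+* L) ((StdForm.antidiagonal 2).over L)))) * g) := fun qq θ => by
    rw [← hθ₁ qq θ]; simp only [mul_assoc]
  -- DCT for series on `[0, 2π]`
  have hDCT := intervalIntegral.hasSum_integral_of_dominated_convergence (μ := volume) (a := (0 : ℝ)) (b := 2 * π)
    (F := fun (qq : Quotient (MulAction.orbitRel ↥(borelU ((IsCMField.complexConj L : L ≃ₐ[↥(maximalRealSubfield L)] L) : L →+* L) ((StdForm.antidiagonal 2).over L))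
        ↥(unitaryGroupOfForm ((IsCMField.complexConj L : L ≃ₐ[↥(maximalRealSubfield L)] L) : L →+* L) ((StdForm.antidiagonal 2).over L)))) (θ : ℝ) =>
      Complex.exp (-((q : ℂ) * θ * Complex.I)) * f (((quasiSplit (↥(maximalRealSubfield L)) L (IsCMField.complexConj L) 2).toAdelic
          (Quotient.out qq : ↥(unitaryGroupOfForm ((IsCMField.complexConj L : L ≃ₐ[↥(maximalRealSubfield L)] L) : L →+* L) ((StdForm.antidiagonal 2).over L)))) * (g * circleAt L w 1 (Circle.exp θ) * torusAt L w a)))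
    (f := fun θ => Complex.exp (-((q : ℂ) * θ * Complex.I)) * eisensteinSeriesU f (g * circleAt L w 1 (Circle.exp θ) * torusAt L w a))
    (fun qq θ => M * ‖f (((quasiSplit (↥(maximalRealSubfield L)) L (IsCMField.complexConj L) 2).toAdelic
          (Quotient.out qq : ↥(unitaryGroupOfForm ((IsCMField.complexConj L : L ≃ₐ[↥(maximalRealSubfield L)] L) : L →+* L) ((StdForm.antidiagonal 2).over L)))) * g)‖)
    (fun qq => by
      have hc : Continuous fun θ : ℝ => archTorusIntegrand s (p - q) a (θ + θ₁ qq) * f (((quasiSplit (↥(maximalRealSubfield L)) L (IsCMField.complexConj L) 2).toAdelic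
          (Quotient.out qq : ↥(unitaryGroupOfForm ((IsCMField.complexConj L : L ≃ₐ[↥(maximalRealSubfield L)] L) : L →+* L) ((StdForm.antidiagonal 2).over L)))) * g) :=
        ((continuous_archTorusIntegrand s (p - q) ha).comp (continuous_id.add continuous_const)).mul continuous_const
      refine (hc.aestronglyMeasurable).congr (Filter.Eventually.of_forall fun θ => ?_)
      exact (hterm qq θ).symm)
    (fun qq => Filter.Eventually.of_forall fun θ _ => by
      rw [hterm, norm_mul]
      exact mul_le_mul_of_nonneg_right (hM _) (norm_nonneg _))
    (Filter.Eventually.of_forall fun θ _ => (hsum.mul_left M))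
    intervalIntegrable_const
    (Filter.Eventually.of_forall fun θ _ => by
      have hs : Summable fun qq : Quotient (MulAction.orbitRel ↥(borelU ((IsCMField.complexConj L : L ≃ₐ[↥(maximalRealSubfield L)] L) : L →+* L) ((StdForm.antidiagonal 2).over L))
        ↥(unitaryGroupOfForm ((IsCMField.complexConj L : L ≃ₐ[↥(maximalRealSubfield L)] L) : L →+* L) ((StdForm.antidiagonal 2).over L))) =>
          Complex.exp (-((q : ℂ) * θ * Complex.I)) * f (((quasiSplit (↥(maximalRealSubfield L)) L (IsCMField.complexConj L) 2).toAdelic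
          (Quotient.out qq : ↥(unitaryGroupOfForm ((IsCMField.complexConj L : L ≃ₐ[↥(maximalRealSubfield L)] L) : L →+* L) ((StdForm.antidiagonal 2).over L)))) * (g * circleAt L w 1 (Circle.exp θ) * torusAt L w a)) :=
        Summable.of_norm_bounded (hsum.mul_left M) fun qq => by
          rw [hterm, norm_mul]
          exact mul_le_mul_of_nonneg_right (hM _) (norm_nonneg _)
      have h := hs.hasSum
      rwa [tsum_mul_left, ← eisensteinSeriesU_def] at h)
  -- termwise: ★ (ii-b) at the points `γ̃_q g`
  have hI : ∀ qq : Quotient (MulAction.orbitRel ↥(borelU ((IsCMField.complexConj L : L ≃ₐ[↥(maximalRealSubfield L)] L) : L →+* L) ((StdForm.antidiagonal 2).over L))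
        ↥(unitaryGroupOfForm ((IsCMField.complexConj L : L ≃ₐ[↥(maximalRealSubfield L)] L) : L →+* L) ((StdForm.antidiagonal 2).over L))),
      (∫ θ in (0 : ℝ)..2 * π, Complex.exp (-((q : ℂ) * θ * Complex.I)) * f (((quasiSplit (↥(maximalRealSubfield L)) L (IsCMField.complexConj L) 2).toAdelic
          (Quotient.out qq : ↥(unitaryGroupOfForm ((IsCMField.complexConj L : L ≃ₐ[↥(maximalRealSubfield L)] L) : L →+* L) ((StdForm.antidiagonal 2).over L)))) * (g * circleAt L w 1 (Circle.exp θ) * torusAt L w a))) =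
        (∫ θ in (0 : ℝ)..2 * π, archTorusIntegrand s (p - q) a θ) * f (((quasiSplit (↥(maximalRealSubfield L)) L (IsCMField.complexConj L) 2).toAdelic
          (Quotient.out qq : ↥(unitaryGroupOfForm ((IsCMField.complexConj L : L ≃ₐ[↥(maximalRealSubfield L)] L) : L →+* L) ((StdForm.antidiagonal 2).over L)))) * g) := fun qq => by
    simp_rw [← mul_assoc]
    exact circleAverage_torusAt_eq L w f s p q hBglob hK hB ha _
  simp_rw [hI] at hDCT
  rw [← hDCT.tsum_eq, tsum_mul_left, ← eisensteinSeriesU_def]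

/-- **NORMALISED FORM**: `(2π)⁻¹ ∫₀^{2π} e^{−iqθ} E(f)(g·circleAt 1 (e^{iθ})·torusAt a) dθ = archTorusCoeff s (p − q) a · E(f)(g)` — with `f := flatSectionU φ z`, `s := z + it_w`, `1 < Re z`
this is the Eisenstein-series half of the `hmc` letter of ★ `arch_unitarity_of_rightRegular_matrixCoeff`. [cite: Knapp1986, VII §1] [cite: MoeglinWaldspurger1995, IV.3] -/
theorem circleAverage_torusAt_eisensteinSeriesU_eq_archTorusCoeff_mul (f : (quasiSplit (↥(maximalRealSubfield L)) L (IsCMField.complexConj L) 2).Adelic → ℂ) (s : ℂ) (p q : ℤ)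
    (hBglob : ∀ b ∈ borelAdelic (↥(maximalRealSubfield L)) L (IsCMField.complexConj L) 2, ∃ c : ℂ, ∀ x, f (b * x) = c * f x)
    (hK : ∀ x (u v : Circle), f (x * circleAt L w u v) = (u : ℂ) ^ p * (v : ℂ) ^ q * f x)
    (hB : ∀ (b : archLocal L 2 ((StdForm.antidiagonal 2).over L) w) (r : ℝ), 0 < r →
      (((b : GL (Fin 2) ℂ) : Matrix (Fin 2) (Fin 2) ℂ) 1 0 = 0) → (((b : GL (Fin 2) ℂ) : Matrix (Fin 2) (Fin 2) ℂ) 0 0 = (r : ℂ)) →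
      ∀ x, f (adelicSingle (↥(maximalRealSubfield L)) L (IsCMField.complexConj L) 2 ((StdForm.antidiagonal 2).over L) (IsCMField.complexConj_ne_one L)
        (complexConj_smul_infinitePlace L) w b * x) = ((r ^ 2 : ℝ) : ℂ) ^ s * f x)
    {a : ℝ} (ha : 0 < a)
    (g : (quasiSplit (↥(maximalRealSubfield L)) L (IsCMField.complexConj L) 2).Adelic)
    (hsum : Summable fun qq : Quotient (MulAction.orbitRel ↥(borelU ((IsCMField.complexConj L : L ≃ₐ[↥(maximalRealSubfield L)] L) : L →+* L) ((StdForm.antidiagonal 2).over L))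
        ↥(unitaryGroupOfForm ((IsCMField.complexConj L : L ≃ₐ[↥(maximalRealSubfield L)] L) : L →+* L) ((StdForm.antidiagonal 2).over L))) =>
      ‖f (((quasiSplit (↥(maximalRealSubfield L)) L (IsCMField.complexConj L) 2).toAdelic
          (Quotient.out qq : ↥(unitaryGroupOfForm ((IsCMField.complexConj L : L ≃ₐ[↥(maximalRealSubfield L)] L) : L →+* L) ((StdForm.antidiagonal 2).over L)))) * g)‖) :
    ((2 * π)⁻¹ : ℝ) • ∫ θ in (0 : ℝ)..2 * π, Complex.exp (-((q : ℂ) * θ * Complex.I)) *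
        eisensteinSeriesU f (g * circleAt L w 1 (Circle.exp θ) * torusAt L w a) =
      archTorusCoeff s (p - q) a * eisensteinSeriesU f g := by
  rw [circleAverage_torusAt_eisensteinSeriesU_eq L w f s p q hBglob hK hB ha g hsum, archTorusCoeff_def, Complex.real_smul, Complex.real_smul]
  ring

end Summit.HodgeConjecture.HodgeConjecture.Cruxes.H413.K2E1ArchTorusActionEisensteinU11

end
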